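import Mathlib.NumberTheory.Chebyshev
import Literature.Computability.AlgebraicComplexity.BurgisserBooleanPartsA3Steps
import Literature.Computability.AlgebraicComplexity.BurgisserBooleanPartsProofs
import Literature.Computability.AlgebraicComplexity.BurgisserBooleanPartsModPCircuits
import Literature.Computability.AlgebraicComplexity.BurgisserReductionModPrimes
import Literature.Computability.AlgebraicComplexity.PowerSumNonvanishing
import HarnessLib

/-!
# (A3) from Theorem 4.1 alone: Bürgisser's `BP(VP_k) ⊆ FP/poly` assembled

Trunk T-CPLX-ALG. This file proves the named fact `booleanPart_VP_cktSize k` ((A3) of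
`BurgisserBooleanParts.lean`: under GRH and in characteristic zero a Boolean part of a
p-computable family has polynomial-size Boolean circuits; Bürgisser, TCS 235 (2000), Thm. 1.1(1),
§5 (A3), pp. 85–86) from the single number-theoretic named fact `reduction_mod_primes_of_GRH`
(TCS Thm. 4.1, reduction of solvable integer systems modulo many small primes under GRH):
`booleanPart_VP_cktSize_of_reduction_mod_primes`. Consequently the target fact
`PPoly_eq_polyAdvice_NP_of_VP_eq_VNP k` of `ValiantBooleanBridge.lean` (TCS Cor. 1.2(1):
`VP_k = VNP_k` in characteristic zero and GRH give `P/poly = NP/poly`) follows from Thm. 4.1 alone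
(`PPoly_eq_polyAdvice_NP_of_VP_eq_VNP_of_reduction_mod_primes`), all other steps of the printed
proof being proved in the tree ((A2) and the assembly in `BurgisserBooleanParts.lean`,
`BurgisserBooleanPartsProofs.lean`; the skeleton lemma, the transfer to `ℂ` and the prime
selection in `BurgisserBooleanPartsA3Steps.lean`; the Boolean simulation of arithmetic modulo
`p` in `BurgisserBooleanPartsModPCircuits.lean`).

## The printed proof of (A3) (TCS pp. 85–86) and its formalisation

"Let `f_n` be p-computable with Boolean part `φ`, `φ_n(x) < 2^{t(n)}`. [1] Replace the constants
of an optimal circuit for `f_n` by indeterminates `Y`: `F_n ∈ ℤ[X, Y]` with `F_n(X, y) = f_n`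
[`exists_skeleton`]. [2] The system `S_n = {F_n(x, Y) - φ_n(x) = 0 : x ∈ {0,1}ⁿ}` is solvable
over `k`, hence by the Nullstellensatz over `ℂ` [`exists_complex_solution_of_charZero`].
[3] `deg`, `log wt` are small [size form of Lemma 2.4, in `exists_skeleton`; partial evaluation
at Boolean points does not increase them, `totalDegree_boolPartialEval_le` (via
`Literature.Computability.AlgebraicComplexity.totalDegree_aeval_le_of_forall_le_one` of `PowerSumNonvanishing.lean`),
`weight_boolPartialEval_le`]. [4] Theorem 4.1 (GRH) with `x = 2^{n^c}` and Chebyshev's bound give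
`π_{S_n}(x) > 2^{t(n)}` [`reduction_mod_primes_of_GRH` + `analytic_step`, Chebyshev from Mathlib's
`Chebyshev.pi_ge`], hence [5] a prime `p_n`, `t(n) < log p_n ≤ n^c`, with `S_n` solvable over
`𝔽_{p_n}` [`exists_prime_gt_of_lt_solvableModPrimeCount`]. [6] Evaluate `F_n(x, y_{p_n})` in
`𝔽_{p_n}` by Boolean circuits of polynomial size [`cktSize_testBits_aeval_eval`]; since
`φ_n(x) < 2^{t(n)} < p_n` its bits are the bits of `φ_n(x)` [`ZMod.val_cast_of_lt`]."
The printed proof obtains `FNC³/poly` via depth reduction (Thm. 2.5); for the `FP/poly` form of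
(A3) vendored in the tree, size bounds suffice and depth reduction is not needed (the weaker
degree/weight bounds `2^{3s}`, `2^{2^{3s}}` of the size form of Lemma 2.4 are absorbed by choosing
the exponent `μ = primeExp c' R s t` quadratic in the circuit size `s`).

## Design choices

* The exponent constant `c` and the error constant `C` of Thm. 4.1 are existential reals; the
  analytic step produces natural parameters `c' = ⌈c⌉`, `R = R(C)` and the explicit polynomial
  `primeExp c' R s T = 2 (2 (c' (3s+3)(4s+1) + 3 s + T) + R)` for the bit size of the prime, so
  that p-boundedness of the final circuit size is a matter of `IsPBounded` closure lemmas.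
* Chebyshev's theorem is used in Mathlib's explicit form `π(n) ≥ (n log 2 - log(n+1))/log n`
  (`Chebyshev.pi_ge`), giving `π(2^μ) ≥ 2^{μ-1}/μ` for `μ ≥ 3` (`primeCounting_two_pow_ge`); no
  prime number theorem is needed.
* The `2ⁿ` equations of `S_n` are indexed by `Fin (card (Fin n → Bool))` through
  `Fintype.equivFin`, to fit the `Fin s`-indexed statement of Thm. 4.1.

## References

* P. Bürgisser, *Cook's versus Valiant's hypothesis*, Theoret. Comput. Sci. 235 (2000) 71–88:
  Thm. 1.1(1) (p. 73), Thm. 4.1 (p. 79), §5 (A3) (pp. 85–86), Cor. 1.2(1) (p. 74, proof p. 79).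
* P. Bürgisser, *Completeness and Reduction in Algebraic Complexity Theory*, Springer 2000,
  Thm. 4.5, Cor. 4.6 (book version).
* P. L. Chebyshev, *Mémoire sur les nombres premiers*, J. Math. Pures Appl. 17 (1852) 366–390
  (the bound `π(x) ≫ x / log x`; Mathlib `Mathlib.NumberTheory.Chebyshev`).
-/

noncomputable section

open scoped Classical
open MvPolynomial Literature.Computability.Complexity Literature.Computability.AlgebraicComplexity

namespace Literature.Computability.AlgebraicComplexity

universe u

/-! ### Part 1: the analytic step (vii) -/

/-- `V⁴ ≤ 2^V` for `V ≥ 16`. [folklore] -/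
theorem pow_four_le_two_pow {V : ℕ} (hV : 16 ≤ V) : V ^ 4 ≤ 2 ^ V := by
  induction V, hV using Nat.le_induction with
  | base => norm_num
  | succ V hV ih =>
    have h1 : (V + 1) ^ 4 ≤ 2 * V ^ 4 := by
      have h3 : 4 * V ^ 3 + 6 * V ^ 2 + 4 * V + 1 ≤ 16 * V ^ 3 := by nlinarith
      have h4 : 16 * V ^ 3 ≤ V ^ 4 := by
        calc 16 * V ^ 3 ≤ V * V ^ 3 := Nat.mul_le_mul_right _ hV
          _ = V ^ 4 := by ring
      nlinarith
    calc (V + 1) ^ 4 ≤ 2 * V ^ 4 := h1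
      _ ≤ 2 * 2 ^ V := Nat.mul_le_mul_left 2 ih
      _ = 2 ^ (V + 1) := by rw [pow_succ]; ring

/-- The exponent `μ = 2 (2 Y + R)`, `Y = c' E + 3 s + T`, `E = (3 s + 3)(4 s + 1)`, of the prime
bound `x = 2^μ` fed to Thm. 4.1 in (A3) (Bürgisser 2000 TCS, p. 85: "`x := 2^{n^c}`, where `c`
denotes a suitable constant"); here spelled out as a polynomial in the circuit size `s` and the
bit size `T`, with `c' = ⌈c⌉` and a slack constant `R`. [cite: Burgisser2000TCS, §5 (A3) p. 85] -/
def primeExpY (c' s T : ℕ) : ℕ := c' * ((3 * s + 3) * (4 * s + 1)) + 3 * s + T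

/-- See `primeExpY`. [cite: Burgisser2000TCS, §5 (A3) p. 85] -/
def primeExp (c' R s T : ℕ) : ℕ := 2 * (2 * primeExpY c' s T + R)

/-- The key numerical inequality behind (A3): with `V = Y + R ≥ 56 (K + 1) + 16`, the polynomial
factors are absorbed by `2^{V-1}`. [folklore] -/
theorem key_nat_ineq (K Y R s T : ℕ) (hR : 56 * (K + 1) + 16 ≤ R) (hT : T ≤ Y) :
    (4 * Y + 2 * R) * (K * (2 ^ (3 * s) + T + 1 + (4 * Y + 2 * R)) + 2 ^ T) ≤
      2 ^ (3 * s + T + (Y + R) - 1) := by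
  set V := Y + R with hV
  set μ := 4 * Y + 2 * R with hμ
  have hV16 : 16 ≤ V := by omega
  have hV1 : 1 ≤ V := by omega
  -- `2^(V-1) ≥ 28 (K+1) V²`
  have h2V : 28 * (K + 1) * V ^ 2 ≤ 2 ^ (V - 1) := by
    have h4 : V ^ 4 ≤ 2 ^ V := pow_four_le_two_pow hV16
    have hKV : 56 * (K + 1) ≤ V := by omega
    have h5 : 2 * (28 * (K + 1) * V ^ 2) ≤ 2 * 2 ^ (V - 1) := by
      calc 2 * (28 * (K + 1) * V ^ 2) = 56 * (K + 1) * V ^ 2 := by ring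
        _ ≤ V * V ^ 2 := Nat.mul_le_mul_right _ hKV
        _ = V ^ 3 := by ring
        _ ≤ V ^ 3 * V := Nat.le_mul_of_pos_right _ hV1
        _ = V ^ 4 := by ring
        _ ≤ 2 ^ V := h4
        _ = 2 * 2 ^ (V - 1) := by rw [← pow_succ']; congr 1; omega
    exact Nat.le_of_mul_le_mul_left h5 two_pos
  -- absorb the polynomial factors
  have h1 : 1 ≤ 2 ^ (3 * s) := Nat.one_le_two_pow
  have h2 : 1 ≤ 2 ^ T := Nat.one_le_two_pow
  have ha : 2 ^ (3 * s) + T + 1 + μ ≤ 2 ^ (3 * s) * (T + μ + 2) := by nlinarith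
  have hstep : μ * (K * (2 ^ (3 * s) + T + 1 + μ) + 2 ^ T) ≤
      (K + 1) * (2 ^ (3 * s) * 2 ^ T) * (μ * (T + μ + 2)) := by
    have e1 : K * (2 ^ (3 * s) + T + 1 + μ) ≤ K * (2 ^ (3 * s) * 2 ^ T * (T + μ + 2)) := by
      apply Nat.mul_le_mul_left
      calc 2 ^ (3 * s) + T + 1 + μ ≤ 2 ^ (3 * s) * (T + μ + 2) := ha
        _ = 2 ^ (3 * s) * 1 * (T + μ + 2) := by ring
        _ ≤ 2 ^ (3 * s) * 2 ^ T * (T + μ + 2) :=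
          Nat.mul_le_mul_right _ (Nat.mul_le_mul_left _ h2)
    have e2 : 2 ^ T ≤ 2 ^ (3 * s) * 2 ^ T * (T + μ + 2) := by
      calc 2 ^ T = 1 * 2 ^ T * 1 := by ring
        _ ≤ 2 ^ (3 * s) * 2 ^ T * (T + μ + 2) :=
          Nat.mul_le_mul (Nat.mul_le_mul_right _ h1) (by omega)
    calc μ * (K * (2 ^ (3 * s) + T + 1 + μ) + 2 ^ T)
        ≤ μ * (K * (2 ^ (3 * s) * 2 ^ T * (T + μ + 2)) + 2 ^ (3 * s) * 2 ^ T * (T + μ + 2)) :=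
          Nat.mul_le_mul_left _ (Nat.add_le_add e1 e2)
      _ = (K + 1) * (2 ^ (3 * s) * 2 ^ T) * (μ * (T + μ + 2)) := by ring
  have hμV : μ * (T + μ + 2) ≤ 28 * V ^ 2 := by
    have : μ ≤ 4 * V := by omega
    have : T + μ + 2 ≤ 7 * V := by omega
    calc μ * (T + μ + 2) ≤ (4 * V) * (7 * V) := Nat.mul_le_mul ‹μ ≤ 4 * V› ‹_›
      _ = 28 * V ^ 2 := by ring
  calc μ * (K * (2 ^ (3 * s) + T + 1 + μ) + 2 ^ T)
      ≤ (K + 1) * (2 ^ (3 * s) * 2 ^ T) * (μ * (T + μ + 2)) := hstep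
    _ ≤ (K + 1) * (2 ^ (3 * s) * 2 ^ T) * (28 * V ^ 2) := Nat.mul_le_mul_left _ hμV
    _ = (2 ^ (3 * s) * 2 ^ T) * (28 * (K + 1) * V ^ 2) := by ring
    _ ≤ (2 ^ (3 * s) * 2 ^ T) * 2 ^ (V - 1) := Nat.mul_le_mul_left _ h2V
    _ = 2 ^ (3 * s + T + V - 1) := by
      rw [← pow_add, ← pow_add]; congr 1; omega

/-- The strict all-integer form of the main inequality: `(2^T + K 2^H a) μ 2^{c'E} < 2^{μ-1}`. [folklore] -/
theorem key_nat_ineq' (K c' R s T : ℕ) (hR : 56 * (K + 1) + 16 ≤ R) :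
    (2 ^ T + K * 2 ^ (2 * primeExpY c' s T + R) *
        (2 ^ (3 * s) + T + 1 + primeExp c' R s T)) * primeExp c' R s T *
      2 ^ (c' * ((3 * s + 3) * (4 * s + 1))) < 2 ^ (primeExp c' R s T - 1) := by
  set Y := primeExpY c' s T with hY
  set E := (3 * s + 3) * (4 * s + 1) with hE
  set H := 2 * Y + R with hH
  have hμ : primeExp c' R s T = 4 * Y + 2 * R := by simp only [primeExp, ← hY]; ring
  have hTY : T ≤ Y := by simp only [hY, primeExpY]; omega
  have hR1 : 1 ≤ R := by omega
  have hkey := key_nat_ineq K Y R s T hR hTY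
  rw [hμ]
  set μ := 4 * Y + 2 * R with hμdef
  set a := 2 ^ (3 * s) + T + 1 + μ with ha
  have hexp : μ - 1 = c' * E + H + (3 * s + T + (Y + R) - 1) := by
    have : Y = c' * E + 3 * s + T := by simp only [hY, primeExpY, hE]
    omega
  have hHpos : 1 < 2 ^ H := Nat.one_lt_two_pow (by omega)
  have hμpos : 0 < μ := by omega
  -- strictness: `2^T < 2^H 2^T`
  have hstrict : 2 ^ T + K * 2 ^ H * a < 2 ^ H * (K * a + 2 ^ T) := by
    have : 2 ^ T < 2 ^ H * 2 ^ T := lt_mul_left (Nat.two_pow_pos T) hHpos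
    nlinarith
  calc (2 ^ T + K * 2 ^ H * a) * μ * 2 ^ (c' * E)
      < 2 ^ H * (K * a + 2 ^ T) * μ * 2 ^ (c' * E) := by
        apply Nat.mul_lt_mul_of_lt_of_le (Nat.mul_lt_mul_of_lt_of_le hstrict le_rfl hμpos) le_rfl
          (Nat.two_pow_pos _)
    _ = 2 ^ (c' * E) * 2 ^ H * (μ * (K * a + 2 ^ T)) := by ring
    _ ≤ 2 ^ (c' * E) * 2 ^ H * 2 ^ (3 * s + T + (Y + R) - 1) := Nat.mul_le_mul_left _ hkey
    _ = 2 ^ (μ - 1) := by rw [hexp, hH]; ring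

/-- `π(2^μ) ≥ 2^{μ-1}/μ` for `μ ≥ 3`, from Chebyshev's bound `π(n) ≥ (n log 2 - log(n+1))/log n`
(Mathlib `Chebyshev.pi_ge`). [folklore] -/
theorem primeCounting_two_pow_ge {μ : ℕ} (hμ : 3 ≤ μ) :
    (2 : ℝ) ^ (μ - 1) / μ ≤ (Nat.primeCounting (2 ^ μ) : ℝ) := by
  have hπ := Chebyshev.pi_ge (2 ^ μ)
  push_cast at hπ
  have hlog2 : 0 < Real.log 2 := Real.log_pos one_lt_two
  have hμpos : (0 : ℝ) < μ := by exact_mod_cast (show 0 < μ by omega)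
  have hlogx : Real.log ((2 : ℝ) ^ μ) = μ * Real.log 2 := Real.log_pow 2 μ
  rw [hlogx] at hπ
  refine le_trans ?_ hπ
  rw [div_le_div_iff₀ hμpos (mul_pos hμpos hlog2)]
  -- `2^(μ-1) (μ log 2) ≤ (2^μ log 2 - log (2^μ + 1)) μ`
  have h1 : Real.log ((2 : ℝ) ^ μ + 1) ≤ (μ + 1) * Real.log 2 := by
    rw [← Real.log_rpow two_pos, Real.rpow_add_one two_ne_zero, Real.rpow_natCast]
    · apply Real.log_le_log (by positivity)
      have : (1 : ℝ) ≤ 2 ^ μ := one_le_pow₀ one_le_two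
      linarith
  have h2 : ((μ : ℝ) + 1) ≤ (2 : ℝ) ^ (μ - 1) := by
    have : μ + 1 ≤ 2 ^ (μ - 1) := by
      have key : ∀ m : ℕ, m + 4 ≤ 2 ^ (m + 2) := by
        intro m
        induction m with
        | zero => norm_num
        | succ m ih =>
          have h' : 2 ^ (m + 1 + 2) = 2 * 2 ^ (m + 2) := by
            rw [show m + 1 + 2 = (m + 2) + 1 by omega, pow_succ]; ring
          omega
      have := key (μ - 3)
      rw [show μ - 3 + 2 = μ - 1 by omega] at this
      omega
    exact_mod_cast this
  have h3 : (2 : ℝ) ^ μ = 2 * 2 ^ (μ - 1) := by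
    rw [← pow_succ']; congr 1; omega
  have h4 : 0 ≤ (2 : ℝ) ^ (μ - 1) := by positivity
  nlinarith [mul_le_mul_of_nonneg_right h2 hlog2.le, mul_nonneg h4 hlog2.le]

/-- **The analytic step of (A3)** (Bürgisser 2000 TCS, §5 (A3), p. 85: "Theorem 4.1 tells us that
`π_{S_n}(x) ≥ π(x)/d_n^{O(m(n))} - x^{1/2} log(w_n x)`. By Chebyshev's [theorem] `π(x) ≥ C x / log x`;
with the choice `x := 2^{n^c}`, where `c` denotes a suitable constant, the above estimate implies
`π_{S_n}(2^{n^c}) > 2^{t(n)}`"): for every `c > 0`, `C ≥ 0` there are naturals `c', R` such that,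
for all `s, T`, with `μ = primeExp c' R s T`, `n = 4 s + 1` unknowns, degree bound
`d = 2^{3s+3}`, weight bound `w = 2^{2^{3s}} + 2^T` and `x = 2^μ`, the main term beats `2^T`:
`2^T < π(x)/d^{c n} - C √x log(w x)`. Chebyshev's lower bound is Mathlib's `Chebyshev.pi_ge`. [cite: Burgisser2000TCS, §5 (A3) p. 85] -/
theorem analytic_step (c C : ℝ) :
    ∃ c' R : ℕ, ∀ s T : ℕ,
      (2 ^ T : ℝ) <
        (Nat.primeCounting (2 ^ primeExp c' R s T) : ℝ) /
            ((2 ^ (3 * s + 3) : ℕ) : ℝ) ^ (c * (4 * s + 1 : ℕ)) -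
          C * Real.sqrt (2 ^ primeExp c' R s T : ℕ) *
            Real.log ((2 ^ 2 ^ (3 * s) + 2 ^ T : ℕ) * (2 ^ primeExp c' R s T : ℕ)) := by
  obtain ⟨c', hc'⟩ : ∃ c' : ℕ, c ≤ c' := ⟨⌈c⌉₊, Nat.le_ceil c⟩
  obtain ⟨K, hK⟩ : ∃ K : ℕ, C ≤ K := ⟨⌈C⌉₊, Nat.le_ceil C⟩
  refine ⟨c', 56 * (K + 1) + 16, fun s T => ?_⟩
  -- the exponent comparison behind (R1), before any abbreviation is introduced
  have hexple : (3 * (s : ℝ) + 3) * (c * (4 * s + 1)) ≤ (c' : ℝ) * ((3 * s + 3) * (4 * s + 1)) := by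
    have h1 : (0 : ℝ) ≤ 3 * s + 3 := by positivity
    have h2 : (0 : ℝ) ≤ 4 * s + 1 := by positivity
    nlinarith [mul_nonneg h1 h2]
  set R := 56 * (K + 1) + 16 with hR
  set Y := primeExpY c' s T with hY
  set E := (3 * s + 3) * (4 * s + 1) with hE
  set H := 2 * Y + R with hH
  set μ := primeExp c' R s T with hμ
  have hμH : μ = 2 * H := by simp only [hμ, primeExp, hH, hY]
  have hμ3 : 3 ≤ μ := by omega
  have hCK : C ≤ K := hK
  set a : ℕ := 2 ^ (3 * s) + T + 1 + μ with ha
  -- (N1) in `ℕ`, cast to `ℝ`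
  have hN := key_nat_ineq' K c' R s T le_rfl
  simp only [← hY, ← hμ, ← hE, ← hH, ← ha] at hN
  have hNr : ((2 ^ T + K * 2 ^ H * a) * μ * 2 ^ (c' * E) : ℝ) < 2 ^ (μ - 1) := by
    exact_mod_cast hN
  -- (R1) the denominator
  have hD : ((2 ^ (3 * s + 3) : ℕ) : ℝ) ^ (c * (4 * s + 1 : ℕ)) ≤ (2 : ℝ) ^ (c' * E) := by
    push_cast
    rw [← Real.rpow_natCast (2 : ℝ) (3 * s + 3), ← Real.rpow_mul zero_le_two,
      ← Real.rpow_natCast (2 : ℝ) (c' * E)]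
    apply Real.rpow_le_rpow_of_exponent_le one_le_two
    rw [hE]
    push_cast
    exact hexple
  have hDpos : 0 < ((2 ^ (3 * s + 3) : ℕ) : ℝ) ^ (c * (4 * s + 1 : ℕ)) := by positivity
  -- (R2) Chebyshev
  have hπ : (2 : ℝ) ^ (μ - 1) / μ ≤ (Nat.primeCounting (2 ^ μ) : ℝ) := primeCounting_two_pow_ge hμ3
  -- (R3) the square root
  have hsqrt : Real.sqrt ((2 ^ μ : ℕ) : ℝ) = (2 : ℝ) ^ H := by
    push_cast
    rw [hμH, mul_comm 2 H, pow_mul, Real.sqrt_sq (by positivity)]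
  -- (R4) the logarithm
  have hWXnat : (2 ^ 2 ^ (3 * s) + 2 ^ T) * 2 ^ μ ≤ 2 ^ a := by
    have hu : 2 ^ 2 ^ (3 * s) ≤ 2 ^ (2 ^ (3 * s) + T) :=
      Nat.pow_le_pow_right two_pos (Nat.le_add_right _ _)
    have hv : 2 ^ T ≤ 2 ^ (2 ^ (3 * s) + T) :=
      Nat.pow_le_pow_right two_pos (Nat.le_add_left _ _)
    calc (2 ^ 2 ^ (3 * s) + 2 ^ T) * 2 ^ μ ≤ (2 ^ (2 ^ (3 * s) + T) + 2 ^ (2 ^ (3 * s) + T)) * 2 ^ μ :=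
          Nat.mul_le_mul_right _ (Nat.add_le_add hu hv)
      _ = 2 ^ (2 ^ (3 * s) + T + 1 + μ) := by simp only [pow_add, pow_one]; ring
      _ = 2 ^ a := by rw [ha]
  have hWX1 : (1 : ℝ) ≤ ((2 ^ 2 ^ (3 * s) + 2 ^ T : ℕ) : ℝ) * ((2 ^ μ : ℕ) : ℝ) := by
    have : 1 ≤ (2 ^ 2 ^ (3 * s) + 2 ^ T) * 2 ^ μ :=
      Nat.one_le_iff_ne_zero.2 (Nat.mul_ne_zero (by positivity) (by positivity))
    exact_mod_cast this
  have hL0 : 0 ≤ Real.log (((2 ^ 2 ^ (3 * s) + 2 ^ T : ℕ) : ℝ) * ((2 ^ μ : ℕ) : ℝ)) :=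
    Real.log_nonneg hWX1
  have hLa : Real.log (((2 ^ 2 ^ (3 * s) + 2 ^ T : ℕ) : ℝ) * ((2 ^ μ : ℕ) : ℝ)) ≤ (a : ℝ) := by
    have h1 : ((2 ^ 2 ^ (3 * s) + 2 ^ T : ℕ) : ℝ) * ((2 ^ μ : ℕ) : ℝ) ≤ (2 : ℝ) ^ a := by
      exact_mod_cast hWXnat
    calc Real.log (((2 ^ 2 ^ (3 * s) + 2 ^ T : ℕ) : ℝ) * ((2 ^ μ : ℕ) : ℝ))
        ≤ Real.log ((2 : ℝ) ^ a) := Real.log_le_log (by linarith) h1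
      _ = a * Real.log 2 := Real.log_pow 2 a
      _ ≤ a * 1 := by
          apply mul_le_mul_of_nonneg_left _ (Nat.cast_nonneg a)
          have := Real.log_le_sub_one_of_pos two_pos
          linarith
      _ = a := mul_one _
  -- combine
  have hden : (0 : ℝ) < μ * 2 ^ (c' * E) := by positivity
  have hmain : (2 ^ T : ℝ) + K * 2 ^ H * a < 2 ^ (μ - 1) / (μ * 2 ^ (c' * E)) := by
    rw [lt_div_iff₀ hden]
    calc ((2 : ℝ) ^ T + K * 2 ^ H * a) * (μ * 2 ^ (c' * E))
        = (2 ^ T + K * 2 ^ H * a) * μ * 2 ^ (c' * E) := by ring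
      _ < 2 ^ (μ - 1) := hNr
  have hπ0 : (0 : ℝ) ≤ Nat.primeCounting (2 ^ μ) := Nat.cast_nonneg _
  have hπD : (2 : ℝ) ^ (μ - 1) / (μ * 2 ^ (c' * E)) ≤
      (Nat.primeCounting (2 ^ μ) : ℝ) / ((2 ^ (3 * s + 3) : ℕ) : ℝ) ^ (c * (4 * s + 1 : ℕ)) := by
    calc (2 : ℝ) ^ (μ - 1) / (μ * 2 ^ (c' * E)) = (2 : ℝ) ^ (μ - 1) / μ / 2 ^ (c' * E) := by
          rw [div_div]
      _ ≤ (Nat.primeCounting (2 ^ μ) : ℝ) / 2 ^ (c' * E) :=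
          div_le_div_of_nonneg_right hπ (by positivity)
      _ ≤ (Nat.primeCounting (2 ^ μ) : ℝ) / ((2 ^ (3 * s + 3) : ℕ) : ℝ) ^ (c * (4 * s + 1 : ℕ)) :=
          div_le_div_of_nonneg_left hπ0 hDpos hD
  have herr : C * Real.sqrt ((2 ^ μ : ℕ) : ℝ) *
      Real.log (((2 ^ 2 ^ (3 * s) + 2 ^ T : ℕ) : ℝ) * ((2 ^ μ : ℕ) : ℝ)) ≤ K * 2 ^ H * a := by
    rw [hsqrt]
    have h2H : (0 : ℝ) ≤ 2 ^ H := by positivity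
    calc C * (2 : ℝ) ^ H * Real.log (((2 ^ 2 ^ (3 * s) + 2 ^ T : ℕ) : ℝ) * ((2 ^ μ : ℕ) : ℝ))
        ≤ K * (2 : ℝ) ^ H * Real.log (((2 ^ 2 ^ (3 * s) + 2 ^ T : ℕ) : ℝ) * ((2 ^ μ : ℕ) : ℝ)) :=
          mul_le_mul_of_nonneg_right (mul_le_mul_of_nonneg_right hCK h2H) hL0
      _ ≤ K * (2 : ℝ) ^ H * a :=
          mul_le_mul_of_nonneg_left hLa (mul_nonneg (Nat.cast_nonneg K) h2H)
  have hx : ((2 ^ primeExp c' R s T : ℕ) : ℝ) = ((2 ^ μ : ℕ) : ℝ) := by rw [hμ]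
  rw [hx]
  linarith [hmain, hπD, herr]

/-! ### Part 2: the integer system `S_n`: partial evaluation at Boolean points -/

section System

variable {n m : ℕ}

/-- The integer Boolean point `boolPoint ℤ x` has coordinates of absolute value `≤ 1`. [folklore] -/
theorem natAbs_boolPoint_le (x : Fin n → Bool) (i : Fin n) : (boolPoint ℤ x i).natAbs ≤ 1 := by
  by_cases h : x i <;> simp [boolPoint, h]

/-- Partial evaluation of `F ∈ ℤ[X_1..X_n, Y_1..Y_m]` at the Boolean point `x`: the polynomial
`F(x, Y) ∈ ℤ[Y]` (Bürgisser 2000 TCS, §5 (A3), p. 85: the equations `F_n(x, Y) - f_n(x) = 0`,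
`x ∈ {0,1}ⁿ`, of the system `S_n`). [cite: Burgisser2000TCS, §5 (A3) p. 85] -/
def boolPartialEval (x : Fin n → Bool) (F : MvPolynomial (Fin n ⊕ Fin m) ℤ) :
    MvPolynomial (Fin m) ℤ :=
  aeval (Sum.elim (fun i => C (boolPoint ℤ x i)) X) F

/-- Evaluating `F(x, Y)` at `Y = w` is evaluating `F` at the point `(boolPoint R x, w)`. [folklore] -/
theorem aeval_boolPartialEval {R : Type*} [CommRing R] (w : Fin m → R) (x : Fin n → Bool)
    (F : MvPolynomial (Fin n ⊕ Fin m) ℤ) :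
    aeval w (boolPartialEval x F) = aeval (Sum.elim (boolPoint R x) w) F := by
  rw [boolPartialEval, MvPolynomial.comp_aeval_apply]
  have hfun : (fun v => aeval w (Sum.elim (fun i => C (boolPoint ℤ x i)) X v)) =
      Sum.elim (boolPoint R x) w := by
    funext v
    rcases v with i | j
    · simp only [Sum.elim_inl, boolPoint_apply]
      split_ifs <;> simp
    · simp
  rw [hfun]

/-- `wt(f ^ n) ≤ wt(f) ^ n`. [folklore] -/
theorem weight_pow_le {σ : Type*} (f : MvPolynomial σ ℤ) (n : ℕ) : weight (f ^ n) ≤ weight f ^ n := by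
  induction n with
  | zero => simp
  | succ n ih =>
    rw [pow_succ, pow_succ]
    exact (weight_mul_le _ _).trans (Nat.mul_le_mul_right _ ih)

/-- Substituting polynomials of weight `≤ 1` (e.g. `0`, `±1`, variables) does not increase the
weight (Bürgisser 2000 TCS, §5 (A3), p. 85: the weight bound of `S_n`). [cite: Burgisser2000TCS, §5 (A3) p. 85] -/
theorem weight_aeval_le_of_forall_le_one {σ τ : Type*} (g : σ → MvPolynomial τ ℤ)
    (hg : ∀ v, weight (g v) ≤ 1) (F : MvPolynomial σ ℤ) : weight (aeval g F) ≤ weight F := by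
  classical
  conv_lhs => rw [F.as_sum]
  rw [map_sum]
  refine (weight_finset_sum_le _ _).trans ?_
  show _ ≤ F.support.sum fun d => (F.coeff d).natAbs
  refine Finset.sum_le_sum fun d _ => ?_
  rw [aeval_monomial, MvPolynomial.algebraMap_eq]
  refine (weight_mul_le _ _).trans ?_
  rw [weight_C]
  refine (Nat.mul_le_mul_left _ ?_).trans (le_of_eq (Nat.mul_one _))
  simp only [Finsupp.prod]
  refine (weight_finset_prod_le _ _).trans (Finset.prod_le_one (fun _ _ => Nat.zero_le _) ?_)
  intro i _
  refine (weight_pow_le _ _).trans ?_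
  calc weight (g i) ^ d i ≤ 1 ^ d i := Nat.pow_le_pow_left (hg i) _
    _ = 1 := one_pow _

/-- Partial evaluation at a Boolean point does not increase the total degree. [cite: Burgisser2000TCS, §5 (A3) p. 85] -/
theorem totalDegree_boolPartialEval_le (x : Fin n → Bool) (F : MvPolynomial (Fin n ⊕ Fin m) ℤ) :
    (boolPartialEval x F).totalDegree ≤ F.totalDegree := by
  refine Literature.Computability.AlgebraicComplexity.totalDegree_aeval_le_of_forall_le_one _ (fun v => ?_) F
  rcases v with i | j
  · simp only [Sum.elim_inl, totalDegree_C]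
    exact Nat.zero_le _
  · simp only [Sum.elim_inr]
    nontriviality ℤ
    rw [totalDegree_X]

/-- Partial evaluation at a Boolean point does not increase the weight. [cite: Burgisser2000TCS, §5 (A3) p. 85] -/
theorem weight_boolPartialEval_le (x : Fin n → Bool) (F : MvPolynomial (Fin n ⊕ Fin m) ℤ) :
    weight (boolPartialEval x F) ≤ weight F := by
  refine weight_aeval_le_of_forall_le_one _ (fun v => ?_) F
  rcases v with i | j
  · simp only [Sum.elim_inl, weight_C]
    exact natAbs_boolPoint_le x i
  · simp

/-- `4 s + 1 < 2^{3s+3}`: the number of slot unknowns is below the degree bound fed to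
Thm. 4.1 (its side condition `n < d`). [folklore] -/
theorem four_mul_add_one_lt_two_pow (s : ℕ) : 4 * s + 1 < 2 ^ (3 * s + 3) := by
  have h1 : s < 2 ^ s := Nat.lt_two_pow_self
  have h2 : 2 ^ s ≤ 2 ^ (3 * s) := Nat.pow_le_pow_right two_pos (by omega)
  have h3 : 2 ^ (3 * s + 3) = 8 * 2 ^ (3 * s) := by rw [pow_add]; ring
  omega

/-- The bits of `1`. [folklore] -/
theorem testBit_one_eq (j : ℕ) : (1 : ℕ).testBit j = decide (j = 0) := by
  rw [← Nat.pow_zero 2, Nat.testBit_two_pow]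
  simp [eq_comm]

/-- The `ℓ` bits of the input residue `[x_i] ∈ {0, 1} ⊆ 𝔽_p`: bit `0` is the input wire, the
other bits are `0` (`ℓ` gates). [folklore] -/
theorem cktSize_testBits_inputResidue {p : ℕ} [Fact (1 < p)] (ℓ n : ℕ) (i : Fin n) :
    CktSize B2 (fun x : Fin n → Bool => testBits ℓ (if x i then (1 : ZMod p) else 0).val)
      (ℓ * 1) := by
  have key : ∀ j : Fin ℓ, CktSizeVia (fun x : Fin n → Bool => x)
      (fun x (_ : Unit) => testBits ℓ (if x i then (1 : ZMod p) else 0).val j) 1 := by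
    intro j
    by_cases hj : (j : ℕ) = 0
    · refine ((CktSizeVia.proj (fun x : Fin n → Bool => x) (fun _ : Unit => i)).of_le
        zero_le_one).congr fun x => ?_
      funext u
      by_cases h : x i
      · simp [h, ZMod.val_one, hj]
      · simp [h]
    · refine CktSizeVia.of_cktSize (cktSize_const _ false) fun x => ?_
      funext u
      by_cases h : x i
      · simp [h, ZMod.val_one, testBit_one_eq, hj]
      · simp [h]
  have := CktSizeVia.pi_const (κ := Fin ℓ) key
  rw [Fintype.card_fin] at this
  exact this.toCktSize

end System

/-! ### Part 3: the assembly of (A3) -/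

section Assembly

variable (k : Type u) [Field k]

/-- The circuit size of the simulation at level `n`, as a function of the arithmetic circuit
size `s = L(f_n)` and the bit size `T = t(n)`: `(3 s + 1) · gateCost μ μ` with
`μ = primeExp c' R s T` (three skeleton gates per gate, one more operand fetch for the output). [folklore] -/
def a3Size (c' R s T : ℕ) : ℕ :=
  (3 * s + 1) * gateCost (primeExp c' R s T) (primeExp c' R s T * 1)

/-- `a3Size c' R` is p-bounded along p-bounded `s` and `T`. [folklore] -/
theorem isPBounded_a3Size (c' R : ℕ) {L t : ℕ → ℕ} (hL : IsPBounded L) (ht : IsPBounded t) :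
    IsPBounded fun n => a3Size c' R (L n) (t n) := by
  have hY : IsPBounded fun n => primeExpY c' (L n) (t n) := by
    unfold primeExpY
    exact IsPBounded.add_holds (IsPBounded.add_holds
      (IsPBounded.mul_holds (IsPBounded.const c')
        (IsPBounded.mul_holds (IsPBounded.add_holds (IsPBounded.mul_holds (IsPBounded.const 3) hL)
          (IsPBounded.const 3))
          (IsPBounded.add_holds (IsPBounded.mul_holds (IsPBounded.const 4) hL) (IsPBounded.const 1))))
      (IsPBounded.mul_holds (IsPBounded.const 3) hL)) ht
  have hμ : IsPBounded fun n => primeExp c' R (L n) (t n) := by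
    unfold primeExp
    exact IsPBounded.mul_holds (IsPBounded.const 2) (IsPBounded.add_holds
      (IsPBounded.mul_holds (IsPBounded.const 2) hY) (IsPBounded.const R))
  have hg : IsPBounded fun n => gateCost (primeExp c' R (L n) (t n))
      (primeExp c' R (L n) (t n) * 1) := by
    refine IsPBounded.mono (t := fun n => 2 * (primeExp c' R (L n) (t n) * 1) +
      65 * (primeExp c' R (L n) (t n) + 2) ^ 3) ?_ fun n => gateCost_le _ _
    exact IsPBounded.add_holds
      (IsPBounded.mul_holds (IsPBounded.const 2) (IsPBounded.mul_holds hμ (IsPBounded.const 1)))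
      (IsPBounded.mul_holds (IsPBounded.const 65)
        (IsPBounded.pow_holds (IsPBounded.add_holds hμ (IsPBounded.const 2)) 3))
  unfold a3Size
  exact IsPBounded.mul_holds
    (IsPBounded.add_holds (IsPBounded.mul_holds (IsPBounded.const 3) hL) (IsPBounded.const 1)) hg

/-- **(A3) at one level `n`** (Bürgisser 2000 TCS, §5 (A3), pp. 85–86, steps [1]–[6] of the
module docstring): given the conclusion of Thm. 4.1 for the constants `c, C`, the parameters
`c', R` of the analytic step, a Boolean part `φ` (bit size `t`) of `f` over a field of
characteristic zero, and a fan-in-two circuit `P` computing `f_n`, the bits of `φ_n(x)` are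
computed from `x ∈ {0,1}ⁿ` by a `B₂`-circuit of size `a3Size c' R P.size (t n)`. [cite: Burgisser2000TCS, §5 (A3) pp. 85–86] -/
theorem cktSize_testBit_of_computes [CharZero k] {c₁ C₁ : ℝ} {c' R : ℕ}
    (h41 : ∀ (n s d w : ℕ) (S : Fin s → MvPolynomial (Fin n) ℤ),
      n < d → (∀ i, (S i).totalDegree ≤ d) → (∀ i, weight (S i) ≤ w) →
      (∃ z : Fin n → ℂ, ∀ i, aeval z (S i) = 0) →
      ∀ x : ℕ, (Nat.primeCounting x : ℝ) / (d : ℝ) ^ (c₁ * n) - C₁ * Real.sqrt x * Real.log (w * x)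
        ≤ (solvableModPrimeCount S x : ℝ))
    (hA : ∀ s T : ℕ, (2 ^ T : ℝ) <
        (Nat.primeCounting (2 ^ primeExp c' R s T) : ℝ) /
            ((2 ^ (3 * s + 3) : ℕ) : ℝ) ^ (c₁ * (4 * s + 1 : ℕ)) -
          C₁ * Real.sqrt (2 ^ primeExp c' R s T : ℕ) *
            Real.log ((2 ^ 2 ^ (3 * s) + 2 ^ T : ℕ) * (2 ^ primeExp c' R s T : ℕ)))
    {f : ∀ n, MvPolynomial (Fin n) k} {φ : ∀ n, (Fin n → Bool) → ℕ} {t : ℕ → ℕ}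
    (hφ : IsBooleanPart k f φ t) (n : ℕ) (P : ArithCircuit k (Fin n)) (hP2 : P.IsFanInTwo)
    (hPf : P.Computes (f n)) :
    CktSize B2 (fun (x : Fin n → Bool) (i : Fin (t n)) => (φ n x).testBit i)
      (a3Size c' R P.size (t n)) := by
  -- [1] the skeleton
  obtain ⟨Q, y, hQ2, -, hQsize, hQeval, hQdeg, hQwt⟩ := exists_skeleton P hP2
  set ℓ := primeExp c' R P.size (t n) with hℓ
  -- [2] the system `S_n`
  set e := Fintype.equivFin (Fin n → Bool) with he
  set G : (Fin n → Bool) → MvPolynomial (Fin (4 * P.size + 1)) ℤ :=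
    fun x => boolPartialEval x Q.eval - MvPolynomial.C (φ n x : ℤ) with hG
  set S : Fin (Fintype.card (Fin n → Bool)) → MvPolynomial (Fin (4 * P.size + 1)) ℤ :=
    fun i => G (e.symm i) with hS
  have hPf' : P.eval = f n := hPf
  have hsolk : ∀ x, aeval y (G x) = 0 := by
    intro x
    have h1 : aeval (Sum.elim (boolPoint k x) y) Q.eval = eval (boolPoint k x) (f n) := by
      rw [← hPf', ← hQeval, map_aeval, aeval_def]
      congr 1
      · exact RingHom.ext_int _ _
      · funext v
        rcases v with i | j
        · simp
        · simp
    simp only [hG, map_sub, aeval_boolPartialEval]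
    rw [h1, hφ.eval_eq]
    simp
  have hsolC : ∃ z : Fin (4 * P.size + 1) → ℂ, ∀ i, aeval z (S i) = 0 :=
    exists_complex_solution_of_charZero S ⟨y, fun i => hsolk _⟩
  -- [3] degree and weight bounds
  have hdeg : ∀ i, (S i).totalDegree ≤ 2 ^ (3 * P.size + 3) := by
    intro i
    simp only [hS, hG]
    refine (totalDegree_sub _ _).trans (max_le ?_ ?_)
    · refine (totalDegree_boolPartialEval_le _ _).trans (hQdeg.trans ?_)
      exact Nat.pow_le_pow_right two_pos (by omega)
    · rw [totalDegree_C]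
      exact Nat.zero_le _
  have hwt : ∀ i, weight (S i) ≤ 2 ^ 2 ^ (3 * P.size) + 2 ^ t n := by
    intro i
    simp only [hS, hG, sub_eq_add_neg]
    refine (weight_add_le _ _).trans (Nat.add_le_add ((weight_boolPartialEval_le _ _).trans hQwt) ?_)
    rw [weight_neg, weight_C, Int.natAbs_natCast]
    exact (hφ.lt n _).le
  -- [4] Theorem 4.1 and the analytic step: `π_S(2^ℓ) > 2^(t n)`
  have h41x := h41 (4 * P.size + 1) _ (2 ^ (3 * P.size + 3)) (2 ^ 2 ^ (3 * P.size) + 2 ^ t n) S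
    (four_mul_add_one_lt_two_pow P.size) hdeg hwt hsolC (2 ^ ℓ)
  have hcount : 2 ^ t n < solvableModPrimeCount S (2 ^ ℓ) := by
    have : (2 ^ t n : ℝ) < (solvableModPrimeCount S (2 ^ ℓ) : ℝ) :=
      lt_of_lt_of_le (hA P.size (t n)) h41x
    exact_mod_cast this
  -- [5] the prime `p_n` and a solution modulo `p_n`
  obtain ⟨p, hp, hTp, hpℓ, zp, hzp⟩ := exists_prime_gt_of_lt_solvableModPrimeCount S hcount
  haveI : Fact (1 < p) := ⟨hp.one_lt⟩
  haveI : NeZero p := ⟨hp.ne_zero⟩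
  have hsolp : ∀ x, aeval (Sum.elim (boolPoint (ZMod p) x) zp) Q.eval = (φ n x : ZMod p) := by
    intro x
    have := hzp (e x)
    simp only [hS, Equiv.symm_apply_apply, hG, map_sub, aeval_boolPartialEval, sub_eq_zero] at this
    rw [this]
    simp
  -- [6] Boolean simulation of `F_n(x, y_p)` in `𝔽_p`
  set z : (Fin n → Bool) → (Fin n ⊕ Fin (4 * P.size + 1)) → ZMod p :=
    fun x => Sum.elim (boolPoint (ZMod p) x) zp with hz
  have hzc : ∀ v, CktSize B2 (fun x => testBits ℓ (z x v).val) (ℓ * 1) := by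
    rintro (i | j)
    · exact (cktSize_testBits_inputResidue (p := p) ℓ n i).congr fun x b => by simp [hz]
    · have := (CktSizeVia.constRow (fun x : Fin n → Bool => x) (testBits ℓ (zp j).val)).toCktSize
      rw [Fintype.card_fin] at this
      exact this.congr fun x b => by simp [hz]
  have hsim := cktSize_testBits_aeval_eval hpℓ z hzc Q hQ2
  have hval : ∀ x, (aeval (z x) Q.eval).val = φ n x := by
    intro x
    have hzx : z x = Sum.elim (boolPoint (ZMod p) x) zp := by rw [hz]
    rw [hzx, hsolp, ZMod.val_cast_of_lt ((hφ.lt n x).trans hTp)]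
  have hTℓ : t n ≤ ℓ := by
    have h2 : 2 ^ t n < 2 ^ ℓ := lt_of_lt_of_le hTp hpℓ
    exact ((Nat.pow_lt_pow_iff_right (by norm_num)).1 h2).le
  refine ((hsim.outMap fun i : Fin (t n) => (⟨i, lt_of_lt_of_le i.2 hTℓ⟩ : Fin ℓ)).congr
    fun x i => ?_).of_le ?_
  · simp [hval]
  · simp only [a3Size, hQsize, ← hℓ]
    exact le_rfl

/-- **(A3) from Theorem 4.1** (Bürgisser 2000 TCS, Thm. 1.1(1) p. 73 and §5 (A3) pp. 85–86,
`BP(VP_k) ⊆ FP/poly` in characteristic zero under GRH): the named fact `booleanPart_VP_cktSize k`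
follows from the reduction-modulo-primes theorem `reduction_mod_primes_of_GRH` (TCS Thm. 4.1,
the only place where GRH enters). All other ingredients — the constant-free skeleton, the
Nullstellensatz transfer to `ℂ`, Chebyshev's bound, the prime selection, the Boolean simulation
of arithmetic modulo `p_n`, and the p-boundedness of the resulting circuit size — are proved. [cite: Burgisser2000TCS, Thm. 1.1(1) p. 73 and §5 (A3) pp. 85–86] -/
theorem booleanPart_VP_cktSize_of_reduction_mod_primes (h41 : reduction_mod_primes_of_GRH) :
    booleanPart_VP_cktSize k := by
  intro _ hERH f φ t hf hφ
  obtain ⟨c, C, -, -, h41'⟩ := h41 hERH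
  obtain ⟨c', R, hA⟩ := analytic_step c C
  have hsizeP : IsPBounded fun n => a3Size c' R (complexity (f n)) (t n) :=
    isPBounded_a3Size c' R hf.2 hφ.isPBounded
  obtain ⟨q, hq⟩ := (isPBounded_iff_exists_polynomial_holds _).1 hsizeP
  refine ⟨q, fun n => ?_⟩
  obtain ⟨P, hP2, hPf, hPs⟩ := ArithCircuit.exists_computes_size_eq_complexity (f n)
  have h := cktSize_testBit_of_computes k h41' hA hφ n P hP2 hPf
  rw [hPs] at h
  exact h.of_le (hq n)

/-- **The target fact from Theorem 4.1 alone**: Bürgisser's `P/poly = NP/poly` under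
`VP_k = VNP_k` (char. 0) and GRH (TCS 235, Cor. 1.2(1), p. 74; book Cor. 4.6(1)), i.e. the named
fact `PPoly_eq_polyAdvice_NP_of_VP_eq_VNP k` of `ValiantBooleanBridge.lean`, follows from the
single named fact `reduction_mod_primes_of_GRH` (TCS Thm. 4.1: effective Chebotarev / reduction
of solvable systems modulo small primes under GRH): (A2), (A3)-minus-Thm-4.1, Arora–Barak
Thm. 6.18 and the assembly are all proved in the tree. [cite: Burgisser2000TCS, Cor. 1.2(1) p. 74 and Thm. 4.1 p. 79] -/
theorem PPoly_eq_polyAdvice_NP_of_VP_eq_VNP_of_reduction_mod_primes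
    (h41 : reduction_mod_primes_of_GRH) : PPoly_eq_polyAdvice_NP_of_VP_eq_VNP k :=
  PPoly_eq_polyAdvice_NP_of_VP_eq_VNP_of_booleanPart_VP_cktSize
    (booleanPart_VP_cktSize_of_reduction_mod_primes k h41)

end Assembly

end Literature.Computability.AlgebraicComplexity

/-! ### The target fact from Theorem 4.5 and Corollary 4.8

With Theorem 4.1 itself assembled from its two printed ingredients in
`BurgisserReductionModPrimes.lean` (`reduction_mod_primes_of_GRH_of_facts`: Thm. 4.5, the
Krick–Pardo height bound, and Cor. 4.8, the GRH-conditional count of primes with a root of the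
minimal polynomial, imply Thm. 4.1; Rem. 4.6 and the bookkeeping proved), (A3) and the target fact
depend on exactly these two external theorems. -/

namespace Literature.Computability.AlgebraicComplexity

universe u

variable (k : Type u) [Field k]

/-- **(A3) from Theorem 4.5 and Corollary 4.8** (Bürgisser 2000 TCS, Thm. 1.1(1) p. 73, §5 (A3)
pp. 85–86, §4 p. 84): the named fact `booleanPart_VP_cktSize k` follows from the two named facts
`algebraicSolution_height_bound` (TCS Thm. 4.5, after Krick–Pardo) and
`rootModPrimeCount_lower_bound_of_GRH` (TCS Cor. 4.8, after Weinberger and Lagarias–Odlyzko);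
every other step of the printed proof is proved in the tree. [cite: Burgisser2000TCS, Thm. 1.1(1) p. 73, Thm. 4.5 p. 82 and Cor. 4.8 p. 84] -/
theorem booleanPart_VP_cktSize_of_heightBound_of_rootCount
    (h45 : algebraicSolution_height_bound) (h48 : rootModPrimeCount_lower_bound_of_GRH) :
    booleanPart_VP_cktSize k :=
  booleanPart_VP_cktSize_of_reduction_mod_primes k (reduction_mod_primes_of_GRH_of_facts h45 h48)

/-- **The target fact from Theorem 4.5 and Corollary 4.8**: Bürgisser's
`VP_k = VNP_k ⟹ P/poly = NP/poly` in characteristic zero under GRH (TCS 235, Cor. 1.2(1),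
p. 74), i.e. the named fact `PPoly_eq_polyAdvice_NP_of_VP_eq_VNP k` of
`ValiantBooleanBridge.lean`, follows from the two named facts `algebraicSolution_height_bound`
(TCS Thm. 4.5: algebraic solutions of small height, Krick–Pardo) and
`rootModPrimeCount_lower_bound_of_GRH` (TCS Cor. 4.8: effective Chebotarev-type count under
GRH, Weinberger/Lagarias–Odlyzko). Proved in the tree: (A2) (Cook–Levin arithmetisation), the
assembly with Arora–Barak Thm. 6.18, the skeleton lemma, the Nullstellensatz transfer, Chebyshev's
bound and the prime selection, the Boolean simulation modulo `p`, Remark 4.6 and the combination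
yielding Thm. 4.1. [cite: Burgisser2000TCS, Cor. 1.2(1) p. 74, Thm. 4.5 p. 82 and Cor. 4.8 p. 84] -/
theorem PPoly_eq_polyAdvice_NP_of_VP_eq_VNP_of_heightBound_of_rootCount
    (h45 : algebraicSolution_height_bound) (h48 : rootModPrimeCount_lower_bound_of_GRH) :
    PPoly_eq_polyAdvice_NP_of_VP_eq_VNP k :=
  PPoly_eq_polyAdvice_NP_of_VP_eq_VNP_of_reduction_mod_primes k
    (reduction_mod_primes_of_GRH_of_facts h45 h48)

end Literature.Computability.AlgebraicComplexity
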